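import Summits.BirchSwinnertonDyer.BirchSwinnertonDyer.Theorems.KatoDescentTamePotSupersingularTameFineSelmerTrivialDoor
import HarnessLib

/-!
# Route `KatoDescentTamePotSupersingular` (rung K8, sub-rung B4 (t′), cell `bsd-potss`): the Selmer-trivial (A)-door on rows with ONE
# multiplicative bad prime — the (c3) binder from `Δ_min ∣ p^a · q^c · c₄^b`, `E(ℚ_p)[p] = 0` and ONE displayed clause at `q`
# (seat `bsd-potss-k8t-c4` g27; `--supports stmt-BirchSwinnertonDyer-19982 --as helper`; closes nothing)

HONEST FRAMING. THEOREMS ONLY (no definition, no named fact, no `sorry`); nothing is booked; BSD / (A) proved for no class of curves.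
Companion of `…TameFineSelmerTrivialDoor` (this seat, p749011): there every bad prime `ℓ ≠ p` was additive (`Δ_min ∣ p^a c₄^b`). On a row
with a multiplicative bad prime `q` the (c3) clause at `q` («`E[p^∞]^{D_q}` has no `p`-torsion», numerically `#E(ℚ_q)[p] = 1` in the
census, conjA-anchor g25 `KT-HLOC-CENSUS`) is a genuine condition that the kernel does not yet discharge (conjA-anchor g26 is typing the
criterion «non-split ∧ q ≢ −1 (mod p)»); this file isolates it as ONE displayed binder `hq`:

* `hbad_of_dvd_pow_mul_pow_mul_pow`: if `Δ_min ∣ p^a · q^c · c₄^b` then every bad place `v ∤ p` is either above `q` (clause displayed) or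
  additive (`ℓ ∣ Δ_min`, `ℓ ∣ c₄`; clause in the kernel by Literature p745700 `geomPrimaryTorsion_eq_zero_of_decomp_fixed_of_hasAdditiveReductionAt`,
  `p ≥ 5`).
* `conjAAt_of_missingUpperBoundAt_of_padic_of_prime`: (A) at `(E,p)` ⟸ `hGZK` + `r_an = 0` + `E[p]` irreducible + U₀ at `(E,p)` + `#Ш_an = s`,
  `ord_p s ≤ 0` + `Δ_min ∣ p^a q^c c₄^b` + `E(ℚ_p)[p] = 0` + the clause at `q` (door `…_of_away` of the companion file).

References: [CoatesSujatha2005] §3 statement (A); [DeoRaySujatha2023] Thm. 3.9 (c3); [SilvermanAEC2009] VII.5.1, VII.6.1–6.2;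
[RaySujatha2021] Cor. 2.7; [Miller2011LMS] Def. 1.1.
-/

set_option autoImplicit false
set_option linter.dupNamespace false

noncomputable section

open scoped Classical NumberField
open WeierstrassCurve NumberField IsDedekindDomain IsDedekindDomain.HeightOneSpectrum Rat.HeightOneSpectrum Field
  Literature.NumberTheory.EllipticCurves Literature.NumberTheory.EllipticCurves.GreenbergSelmer
  Literature.NumberTheory.EllipticCurves.Rank1Residual Literature.NumberTheory.EllipticCurves.Rank1Residual.Typed
  Summit.BirchSwinnertonDyer.BirchSwinnertonDyer.Rank1Residual.IntModel

namespace Summit.BirchSwinnertonDyer.BirchSwinnertonDyer.Theorems.TameFineSelmerTrivialRoad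

variable (W : WeierstrassCurve ℚ) [W.IsElliptic] [W.IsGloballyMinimal]

/-- **The (c3) clauses at the bad places away from `p` from `Δ_min ∣ p^a · q^c · c₄^b` and ONE clause at `q`** (`p ≥ 5`, `W` globally
minimal): the prime `ℓ` under a bad place divides `Δ_min` (Silverman VII.5.1 (a)), hence `p^a q^c c₄^b`; `ℓ = p` is excluded, `ℓ = q` is the
displayed clause, and `ℓ ∣ c₄` (with `ℓ ∣ Δ_min`) is additive reduction (VII.5.1 (c)), where `E[p^∞]^{I_ℓ} = 0` (VII.6.1–6.2, Literature
p745700). [cite: SilvermanAEC2009, VII.5 Prop. 5.1 (a), (c) (PDF p. 174) and Thm. VII.6.1 with Cor. VII.6.2 (PDF p. 177)]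
[cite: DeoRaySujatha2023, §3 Thm. 3.9 (c3)] -/
theorem hbad_of_dvd_pow_mul_pow_mul_pow {p : ℕ} [Fact p.Prime] (hp5 : 5 ≤ p) {q : ℕ} (hq : q.Prime) {a b c : ℕ}
    (hrad : minimalDiscriminantInt W ∣ (p : ℤ) ^ a * (q : ℤ) ^ c * (integralModelInt W).c₄ ^ b)
    (hqc : ∀ v : HeightOneSpectrum (𝓞 ℚ), ((q : ℕ) : 𝓞 ℚ) ∈ v.asIdeal →
      ∀ x : W.geomPrimaryTorsion p, p • x = 0 → (∀ d ∈ decomp v, d • x = x) → x = 0) :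
    ∀ v : HeightOneSpectrum (𝓞 ℚ), ¬ W.HasGoodReductionAt v → ((p : ℕ) : 𝓞 ℚ) ∉ v.asIdeal →
      ∀ x : W.geomPrimaryTorsion p, p • x = 0 → (∀ d ∈ decomp v, d • x = x) → x = 0 := by
  have hp : p.Prime := Fact.out
  intro v hbad hpv x hx hfix
  haveI := Fact.mk (primesEquiv v).2
  have hℓ : ((primesEquiv v : Nat.Primes) : ℕ).Prime := (primesEquiv v).2
  -- `ℓ ∣ Δ_min`
  have hΔ : (((primesEquiv v : Nat.Primes) : ℕ) : ℤ) ∣ minimalDiscriminantInt W := by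
    by_contra hnd
    exact hbad ((hasGoodReductionAtPrime_iff_hasGoodReductionAt_ringOfIntegers v W).mp
      (hasGoodReductionAtPrime_of_not_dvd W _ hnd))
  have hℓZ : Prime ((((primesEquiv v : Nat.Primes) : ℕ) : ℤ)) := Nat.prime_iff_prime_int.mp hℓ
  rcases hℓZ.dvd_or_dvd (hΔ.trans hrad) with h | h
  · rcases hℓZ.dvd_or_dvd h with h' | h'
    · -- `ℓ ∣ p^a`: impossible (`v ∤ p`)
      exfalso
      have h1 : ((primesEquiv v : Nat.Primes) : ℕ) ∣ p := Int.natCast_dvd_natCast.mp (hℓZ.dvd_of_dvd_pow h')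
      have h2 : primesEquiv v = ⟨p, hp⟩ := Subtype.ext ((Nat.prime_dvd_prime_iff_eq hℓ hp).mp h1)
      exact hpv ((natCast_mem_asIdeal_iff_eq_primesEquiv_symm v hp).mpr ((Equiv.eq_symm_apply _).mpr h2))
    · -- `ℓ ∣ q^c`: the displayed clause
      have h1 : ((primesEquiv v : Nat.Primes) : ℕ) ∣ q := Int.natCast_dvd_natCast.mp (hℓZ.dvd_of_dvd_pow h')
      have h2 : primesEquiv v = ⟨q, hq⟩ := Subtype.ext ((Nat.prime_dvd_prime_iff_eq hℓ hq).mp h1)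
      exact hqc v ((natCast_mem_asIdeal_iff_eq_primesEquiv_symm v hq).mpr ((Equiv.eq_symm_apply _).mpr h2)) x hx hfix
  · -- `ℓ ∣ c₄^b`: additive reduction at `v`
    exact W.geomPrimaryTorsion_eq_zero_of_decomp_fixed_of_hasAdditiveReductionAt
      (W.hasAdditiveReductionAt_of_dvd_of_dvd v hΔ (hℓZ.dvd_of_dvd_pow h)) hp hp5 hpv x hx hfix

/-- **(A) at `(E,p)` from the row's U₀ statement on a row with ONE multiplicative bad prime `q`** (`p ≥ 5`): as
`conjAAt_of_missingUpperBoundAt_of_padic`, with `Δ_min ∣ p^a q^c c₄^b` and the (c3) clause at `q` displayed (`hqc`). NOT a road to U₀.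
[cite: CoatesSujatha2005, §3 statement (A)] [cite: RaySujatha2021, Cor. 2.7 (arXiv:2112.13335 p. 6)] [cite: DeoRaySujatha2023, Thm. 3.9 (c3)]
[cite: Miller2011LMS, Def. 1.1] -/
theorem conjAAt_of_missingUpperBoundAt_of_padic_of_prime (hGZK : rank_eq_analyticRank_of_analyticRank_le_one)
    {p : ℕ} [Fact p.Prime] (hp5 : 5 ≤ p) (hr : W.analyticRank = 0) (hirr : W.HasIrreducibleModPGaloisRep p)
    (hU : MissingUpperBoundAt W p) {s : ℚ} (hs : shaAn W = (s : ℂ)) (hsv : padicValRat p s ≤ 0)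
    {q : ℕ} (hq : q.Prime) {a b c : ℕ}
    (hrad : minimalDiscriminantInt W ∣ (p : ℤ) ^ a * (q : ℤ) ^ c * (integralModelInt W).c₄ ^ b)
    (hqc : ∀ v : HeightOneSpectrum (𝓞 ℚ), ((q : ℕ) : 𝓞 ℚ) ∈ v.asIdeal →
      ∀ x : W.geomPrimaryTorsion p, p • x = 0 → (∀ d ∈ decomp v, d • x = x) → x = 0)
    (hQp : ∀ Q : (W.baseChange ℚ_[p]).toAffine.Point, p • Q = 0 → Q = 0) :
    Rank1Residual.ConjAAt W p :=
  conjAAt_of_missingUpperBoundAt_of_padic_of_away W hGZK (by omega) hr hirr hU hs hsv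
    (hbad_of_dvd_pow_mul_pow_mul_pow W hp5 hq hrad hqc) hQp

/-- **Raw form on a row with ONE multiplicative bad prime `q`**: conjA-anchor g24's displayed binders `hMW : p ∤ #E(ℚ)`, `hsha : p ∤ #Ш(E/ℚ)`,
the clause at `q` displayed, the rest of (c3) in the kernel. [cite: CoatesSujatha2005, §3 statement (A)] [cite: DeoRaySujatha2023, Thm. 3.9 (c3)] -/
theorem conjAAt_of_not_dvd_of_padic_of_prime {p : ℕ} [Fact p.Prime] (hp5 : 5 ≤ p)
    (hMW : ¬ p ∣ Nat.card W.toAffine.Point) (hsha : ¬ p ∣ W.shaOrder) {q : ℕ} (hq : q.Prime) {a b c : ℕ}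
    (hrad : minimalDiscriminantInt W ∣ (p : ℤ) ^ a * (q : ℤ) ^ c * (integralModelInt W).c₄ ^ b)
    (hqc : ∀ v : HeightOneSpectrum (𝓞 ℚ), ((q : ℕ) : 𝓞 ℚ) ∈ v.asIdeal →
      ∀ x : W.geomPrimaryTorsion p, p • x = 0 → (∀ d ∈ decomp v, d • x = x) → x = 0)
    (hQp : ∀ Q : (W.baseChange ℚ_[p]).toAffine.Point, p • Q = 0 → Q = 0) :
    Rank1Residual.ConjAAt W p := by
  refine CoatesSujatha2005.SelmerTrivialRoad.conjAAt_of_not_dvd_card_of_not_dvd_shaOrder W (by omega) hMW hsha ?_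
  intro v hv x hx hfix
  by_cases hpv : ((p : ℕ) : 𝓞 ℚ) ∈ v.asIdeal
  · exact hlocp_of_padic W hQp v hpv x hx hfix
  · exact hbad_of_dvd_pow_mul_pow_mul_pow W hp5 hq hrad hqc v (hv.resolve_left hpv) hpv x hx hfix

end Summit.BirchSwinnertonDyer.BirchSwinnertonDyer.Theorems.TameFineSelmerTrivialRoad

end
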